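import Summits.Ventures.HodgeRepro2.T5SU11SphericalGreen
import Summits.Ventures.HodgeRepro2.T5SU11SphericalDecayEdge

/-!
# The resolvent of the radial Laplacian at the spectral edge `λ = 1`: `G_1 f` from the basis `(Ξ, χ_1)`, and its uniqueness

Row 452 built and characterised the Green's solution `G_λ f` for `λ > 1`; its definition `sphGreen` makes sense at
every `λ`, and at the edge `λ = 1` the basis `(Ξ, χ_1)` of row 453 has the same properties (Wronskian `−1`,
`χ_1/Ξ → 0`), so the same statements hold verbatim: **`G_1 f` solves
`sinh 2t · u″ + 2 cosh 2t · u′ = −sinh 2t · u + sinh 2t · f`** on `(0, ∞)` (`sphGreen_one_ode`), is bounded at the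
origin with limit `−∫_a^b χ_1 f sinh 2s` (`tendsto_sphGreen_one_nhdsGT_zero`), satisfies `(G_1 f)/Ξ → 0`
(`tendsto_sphGreen_one_div_atTop`), and **is the unique solution of the inhomogeneous equation with these two
boundary properties** (`eq_sphGreen_one_of_ode`). Nothing is claimed about (N).

Blind lane: Mathlib + the HodgeRepro2 prefix only; no sorry; axioms ⊆ {propext, Classical.choice,
Quot.sound}.
-/

namespace Summit.Ventures.HodgeRepro2.T5SU11SphericalGreenEdge

open Filter Topology
open Set (Ioi)
open T5SU11Cartan T5SU11SphericalFunction T5SU11SphericalBounds T5SU11ReductionOfOrder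
  T5SU11SphericalSolutionSpaceAll T5SU11SphericalRegular T5SU11SphericalDecay T5SU11SphericalDecayEdge
  T5SU11RadialGreen T5SU11SphericalGreen

section measure

variable [MeasurableSpace Circle] [BorelSpace Circle]

variable {a b : ℝ} {f : ℝ → ℝ} (hf : ContinuousOn f (Ioi 0)) (ha : 0 < a) (hab : a ≤ b)

include hf ha hab in
/-- `(G_1 f)′` is the derivative of `G_1 f` on `(0, ∞)`. -/
theorem hasDerivAt_sphGreen_one {t : ℝ} (ht : 0 < t) : HasDerivAt (sphGreen 1 f a b) (sphGreen' 1 f a b t) t :=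
  hasDerivAt_greenSol (hφ_sph 1) (fun _ ht => hasDerivAt_sphDecay_one ht) hf ha hab ht

include hf ha hab in
/-- `(G_1 f)″` is the derivative of `(G_1 f)′` on `(0, ∞)`. -/
theorem hasDerivAt_sphGreen_one' {t : ℝ} (ht : 0 < t) :
    HasDerivAt (sphGreen' 1 f a b) (sphGreen'' 1 f a b t) t :=
  hasDerivAt_greenSol' (hφ_sph 1) (hφ'_sph 1) (fun _ ht => hasDerivAt_sphDecay_one ht)
    (fun _ ht => hasDerivAt_sphDecay' 1 ht) hf ha hab ht

/-- **`G_1 f` solves the inhomogeneous radial equation at the edge**: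
`sinh 2t · u″ + 2 cosh 2t · u′ = −sinh 2t · u + sinh 2t · f` (as `1 · (1 − 2)`). -/
theorem sphGreen_one_ode {t : ℝ} (ht : 0 < t) :
    Real.sinh (2 * t) * sphGreen'' 1 f a b t + 2 * Real.cosh (2 * t) * sphGreen' 1 f a b t
      = 1 * (1 - 2) * Real.sinh (2 * t) * sphGreen 1 f a b t + Real.sinh (2 * t) * f t :=
  greenSol_ode (hode_sph 1) (fun _ ht => sphDecay_one_ode ht) (fun _ ht => wronskian_sphDecay_one ht) ht

include hf ha hab in
/-- On `(0, a]`: `G_1 f = −(∫_a^b χ_1 f sinh 2s) · Ξ`. -/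
theorem sphGreen_one_eq_of_le (hfa : ∀ s, s ≤ a → f s = 0) {t : ℝ} (ht : 0 < t) (hta : t ≤ a) :
    sphGreen 1 f a b t = -(∫ s in a..b, sphDecay 1 s * f s * Real.sinh (2 * s)) * sph 1 (hyp t) :=
  greenSol_eq_of_le (fun _ ht => hasDerivAt_sphDecay_one ht) hf ha hab hfa ht hta

include hf ha hab in
/-- **`G_1 f` has the limit `−∫_a^b χ_1 f sinh 2s` at the origin.** -/
theorem tendsto_sphGreen_one_nhdsGT_zero (hfa : ∀ s, s ≤ a → f s = 0) :
    Tendsto (sphGreen 1 f a b) (𝓝[>] 0) (𝓝 (-(∫ s in a..b, sphDecay 1 s * f s * Real.sinh (2 * s)))) := by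
  have h := (tendsto_sph_hyp_nhdsGT_zero 1).const_mul (-(∫ s in a..b, sphDecay 1 s * f s * Real.sinh (2 * s)))
  rw [mul_one] at h
  refine h.congr' ?_
  filter_upwards [Ioo_mem_nhdsGT ha] with t ht
  exact (sphGreen_one_eq_of_le hf ha hab hfa ht.1 ht.2.le).symm

include hf ha hab in
/-- **`G_1 f` is bounded as `t → 0⁺`.** -/
theorem eventually_abs_sphGreen_one_le (hfa : ∀ s, s ≤ a → f s = 0) :
    ∀ᶠ t in 𝓝[>] (0 : ℝ), |sphGreen 1 f a b t| ≤ |∫ s in a..b, sphDecay 1 s * f s * Real.sinh (2 * s)| + 1 := by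
  filter_upwards [(tendsto_sphGreen_one_nhdsGT_zero hf ha hab hfa).eventually (eventually_abs_sub_lt _ one_pos)]
    with t ht
  set L := -(∫ s in a..b, sphDecay 1 s * f s * Real.sinh (2 * s)) with hL
  calc |sphGreen 1 f a b t| = |(sphGreen 1 f a b t - L) + L| := by ring_nf
    _ ≤ |sphGreen 1 f a b t - L| + |L| := abs_add_le _ _
    _ ≤ |∫ s in a..b, sphDecay 1 s * f s * Real.sinh (2 * s)| + 1 := by
        rw [hL, abs_neg]
        linarith

include hf ha hab in
/-- **`(G_1 f)/Ξ → 0` at infinity.** -/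
theorem tendsto_sphGreen_one_div_atTop (hfb : ∀ s, b ≤ s → f s = 0) :
    Tendsto (fun t => sphGreen 1 f a b t / sph 1 (hyp t)) atTop (𝓝 0) := by
  have h := tendsto_sphDecay_one_div_atTop.const_mul (-(∫ s in a..b, sph 1 (hyp s) * f s * Real.sinh (2 * s)))
  rw [mul_zero] at h
  refine h.congr' ?_
  filter_upwards [eventually_ge_atTop b] with t ht
  rw [sphGreen_eq_of_ge hf ha hab hfb ht]
  ring

include hf ha hab in
/-- **THE GREEN'S SOLUTION AT THE EDGE IS UNIQUE**: a solution `v` of the inhomogeneous equation at `λ = 1` on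
`(0, ∞)` that is bounded as `t → 0⁺` and satisfies `v/Ξ → 0` at infinity equals `G_1 f`. -/
theorem eq_sphGreen_one_of_ode (hfa : ∀ s, s ≤ a → f s = 0) (hfb : ∀ s, b ≤ s → f s = 0)
    {v v' v'' : ℝ → ℝ} (hv : ∀ t, 0 < t → HasDerivAt v (v' t) t) (hv' : ∀ t, 0 < t → HasDerivAt v' (v'' t) t)
    (hvode : ∀ t, 0 < t → Real.sinh (2 * t) * v'' t + 2 * Real.cosh (2 * t) * v' t
      = 1 * (1 - 2) * Real.sinh (2 * t) * v t + Real.sinh (2 * t) * f t)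
    {B : ℝ} (hB : ∀ᶠ t in 𝓝[>] (0 : ℝ), |v t| ≤ B)
    (hdecay : Tendsto (fun t => v t / sph 1 (hyp t)) atTop (𝓝 0)) {t : ℝ} (ht : 0 < t) :
    v t = sphGreen 1 f a b t := by
  set w : ℝ → ℝ := fun t => v t - sphGreen 1 f a b t with hw
  have hwd : ∀ t, 0 < t → HasDerivAt w (v' t - sphGreen' 1 f a b t) t :=
    fun t ht => (hv t ht).sub (hasDerivAt_sphGreen_one hf ha hab ht)
  have hwd' : ∀ t, 0 < t → HasDerivAt (fun t => v' t - sphGreen' 1 f a b t) (v'' t - sphGreen'' 1 f a b t) t :=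
    fun t ht => (hv' t ht).sub (hasDerivAt_sphGreen_one' hf ha hab ht)
  have hwode : ∀ t, 0 < t → Real.sinh (2 * t) * (v'' t - sphGreen'' 1 f a b t)
      + 2 * Real.cosh (2 * t) * (v' t - sphGreen' 1 f a b t) = 1 * (1 - 2) * Real.sinh (2 * t) * w t := by
    intro t ht
    have e1 := hvode t ht
    have e2 := sphGreen_one_ode (f := f) (a := a) (b := b) ht
    simp only [hw]
    linear_combination e1 - e2
  have hwB : ∀ᶠ t in 𝓝[>] (0 : ℝ), |w t| ≤ B + (|∫ s in a..b, sphDecay 1 s * f s * Real.sinh (2 * s)| + 1) := by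
    filter_upwards [hB, eventually_abs_sphGreen_one_le hf ha hab hfa] with t h1 h2
    simp only [hw]
    calc |v t - sphGreen 1 f a b t| ≤ |v t| + |sphGreen 1 f a b t| := abs_sub _ _
      _ ≤ B + (|∫ s in a..b, sphDecay 1 s * f s * Real.sinh (2 * s)| + 1) := add_le_add h1 h2
  have hrep : ∀ s, 0 < s → w s = (w 1 / sph 1 (hyp 1)) * sph 1 (hyp s) :=
    fun s hs => eq_const_mul_sph_of_bounded 1 hwd hwd' hwode hwB hs
  have hwdiv : Tendsto (fun s => w s / sph 1 (hyp s)) atTop (𝓝 0) := by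
    have h := hdecay.sub (tendsto_sphGreen_one_div_atTop hf ha hab hfb)
    rw [sub_zero] at h
    refine h.congr' ?_
    filter_upwards [eventually_gt_atTop 0] with s _
    simp only [hw]
    rw [sub_div]
  have hconst : Tendsto (fun s => w s / sph 1 (hyp s)) atTop (𝓝 (w 1 / sph 1 (hyp 1))) := by
    refine tendsto_const_nhds.congr' ?_
    filter_upwards [eventually_gt_atTop 0] with s hs
    rw [hrep s hs, mul_div_assoc, div_self (sph_hyp_pos 1 s).ne', mul_one]
  have hk : w 1 / sph 1 (hyp 1) = 0 := tendsto_nhds_unique hconst hwdiv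
  have hw0 : w t = 0 := by rw [hrep t ht, hk, zero_mul]
  simp only [hw] at hw0
  linarith

end measure

end Summit.Ventures.HodgeRepro2.T5SU11SphericalGreenEdge
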